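import Summits.AnomalousDissipation.AnomalousDissipation.Theorems.MarginalStabilityChainStrainedLayerLawLine
import Mathlib.MeasureTheory.Integral.IntervalIntegral.Periodic
import Mathlib.Analysis.Calculus.Deriv.Shift

/-! # Stub `stub_coreFloor` of the line `contraction-capture` (crux stmt-AnomalousDissipation-3007
`MarginalStabilityChain.StrainedLayerLaw`)

The TRANSFER step of the line: if from some time `T₂ > 0` on some box `Q = [a-ρ, a+ρ] × [b-ρ, b+ρ]` of each
time slice carries circulation `|Γ_Q| ≥ Γ₀`, then the Cesàro mean dissipation per unit area over the period
`nℓ` is at least `ν Γ₀² / (8 ρ² ℓ)`.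

Route (pure measure theory, entirely in `ℝ≥0∞`, so that no measurability or integrability of the slices is
needed — a non-integrable Bochner slice integral is `0` and every bound below survives):
* `ω² = (∂ₓg − ∂_yf)² ≤ 2 |∇(f, g)|²` pointwise (`vort_sq_le`);
* Cauchy–Schwarz on the box in AM–GM form: `Γ₀ ≤ |∫∫_Q ω| ≤ ∫⁻∫⁻_Q |ω| ≤ 2cρ² + (2c)⁻¹ ∫⁻∫⁻_Q ω²` for every
  scale `c > 0`, and `c = Γ₀/(4ρ²)` gives `∫⁻∫⁻_Q ω² ≥ Γ₀²/(4ρ²)` (`sq_le_box_lintegral`, `box_floor`);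
* the `y`-integrated integrand `E(x) = ∫⁻_y |∇(f,g)|²` is `ℓ`-periodic (`deriv_comp_add_const`), all windows of
  length `ℓ` have the same lower integral (`AddCircle.lintegral_preimage`), `(0, nℓ]` is `n` windows, and the
  window starting at `a − ρ` contains the box since `2ρ ≤ ℓ` (`layerDissipation_floor`);
* Cesàro: a floor `K` on `D(t)` for `t ≥ T₂` gives `T⁻¹ ∫⁻_{(0,T]} D ≥ K (1 − T₂/T) → K`
  (`le_liminf_cesaro_of_floor`).
-/

set_option linter.dupNamespace false

noncomputable section

open scoped BigOperators Topology ENNReal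
open Filter Set Function MeasureTheory

namespace Summit.AnomalousDissipation.AnomalousDissipation.Theorems.StrainedLayerLaw.ContractionCapture

open Literature.Analysis.FluidPDE Literature.Analysis.FluidPDE.StretchedLayer
open Summit.AnomalousDissipation.AnomalousDissipation.Theses.MarginalStabilityChain

/-! ## §1 Pointwise algebra -/

/-- AM–GM with a free scale `c > 0`, in `ℝ≥0∞` form: `|s| ≤ c/2 + s²/(2c)`. [folklore] -/
theorem enorm_le_amgm (s : ℝ) {c : ℝ} (hc : 0 < c) :
    ‖s‖ₑ ≤ ENNReal.ofReal (c / 2) + ENNReal.ofReal (1 / (2 * c)) * ENNReal.ofReal (s ^ 2) := by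
  rw [Real.enorm_eq_ofReal_abs, ← ENNReal.ofReal_mul (by positivity),
    ← ENNReal.ofReal_add (by positivity) (by positivity)]
  refine ENNReal.ofReal_le_ofReal ?_
  rw [← sub_nonneg]
  have h : c / 2 + 1 / (2 * c) * s ^ 2 - |s| = (|s| - c) ^ 2 / (2 * c) := by
    rw [← sq_abs s]
    field_simp
    ring
  rw [h]
  positivity

/-- `ω² = (∂ₓg − ∂_yf)² ≤ 2 |∇(f, g)|²` pointwise. [folklore] -/
theorem vort_sq_le (f g : ℝ → ℝ → ℝ) (x y : ℝ) :
    vort f g x y ^ 2 ≤ 2 * (dX f x y ^ 2 + dY f x y ^ 2 + dX g x y ^ 2 + dY g x y ^ 2) := by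
  unfold vort
  nlinarith [sq_nonneg (dX g x y + dY f x y), sq_nonneg (dX f x y), sq_nonneg (dY g x y)]

/-- The `x`-slice derivative of an `x`-periodic plane field is `x`-periodic (translation invariance of
`deriv`, no differentiability needed). [folklore] -/
theorem dX_add_period {f : ℝ → ℝ → ℝ} {ℓ : ℝ} (hf : ∀ x y : ℝ, f (x + ℓ) y = f x y) (x y : ℝ) :
    dX f (x + ℓ) y = dX f x y := by
  unfold dX
  rw [← deriv_comp_add_const (fun s => f s y) ℓ x]
  simp only [hf]

/-- The `y`-slice derivative of an `x`-periodic plane field is `x`-periodic. [folklore] -/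
theorem dY_add_period {f : ℝ → ℝ → ℝ} {ℓ : ℝ} (hf : ∀ x y : ℝ, f (x + ℓ) y = f x y) (x y : ℝ) :
    dY f (x + ℓ) y = dY f x y := by
  unfold dY
  simp only [hf]

/-! ## §2 Cauchy–Schwarz on a box, in `ℝ≥0∞` -/

/-- **Cauchy–Schwarz on a box, `ℝ≥0∞` form.** If the iterated Bochner integral of `w` over the box
`[a-ρ, a+ρ] × [b-ρ, b+ρ]` has modulus `≥ Γ₀ ≥ 0`, then `∫⁻∫⁻_box w² ≥ Γ₀²/(4ρ²)`; no measurability or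
integrability is presupposed (a non-integrable slice integrates to `0`). Proof: `|∫∫w| ≤ ∫⁻∫⁻|w|`, AM–GM
`|w| ≤ c/2 + w²/(2c)` with `c = Γ₀/(4ρ²)`. [folklore] -/
theorem sq_le_box_lintegral {w : ℝ → ℝ → ℝ} {a b ρ Γ₀ : ℝ} (hρ : 0 < ρ) (hΓ₀ : 0 ≤ Γ₀)
    (hbox : Γ₀ ≤ |∫ x in Icc (a - ρ) (a + ρ), ∫ y in Icc (b - ρ) (b + ρ), w x y|) :
    ENNReal.ofReal (Γ₀ ^ 2 / (4 * ρ ^ 2)) ≤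
      ∫⁻ x in Icc (a - ρ) (a + ρ), ∫⁻ y in Icc (b - ρ) (b + ρ), ENNReal.ofReal (w x y ^ 2) := by
  rcases hΓ₀.eq_or_lt with h0 | hΓpos
  · rw [← h0]; simp
  set W := ∫⁻ x in Icc (a - ρ) (a + ρ), ∫⁻ y in Icc (b - ρ) (b + ρ), ENNReal.ofReal (w x y ^ 2)
    with hW
  by_cases hWtop : W = ∞
  · rw [hWtop]; exact le_top
  -- the scale of the AM–GM step
  obtain ⟨c, hc⟩ : ∃ c : ℝ, c = Γ₀ / (4 * ρ ^ 2) := ⟨_, rfl⟩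
  have hcpos : 0 < c := by rw [hc]; positivity
  have hvol : ∀ z : ℝ, volume (Icc (z - ρ) (z + ρ)) = ENNReal.ofReal (2 * ρ) := by
    intro z; rw [Real.volume_Icc]; congr 1; ring
  -- Step 1: `Γ₀ ≤ ∫⁻∫⁻ |w|`
  have h1 : ENNReal.ofReal Γ₀ ≤
      ∫⁻ x in Icc (a - ρ) (a + ρ), ∫⁻ y in Icc (b - ρ) (b + ρ), ‖w x y‖ₑ := by
    calc ENNReal.ofReal Γ₀
        ≤ ENNReal.ofReal |∫ x in Icc (a - ρ) (a + ρ), ∫ y in Icc (b - ρ) (b + ρ), w x y| :=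
          ENNReal.ofReal_le_ofReal hbox
      _ = ‖∫ x in Icc (a - ρ) (a + ρ), ∫ y in Icc (b - ρ) (b + ρ), w x y‖ₑ :=
          (Real.enorm_eq_ofReal_abs _).symm
      _ ≤ ∫⁻ x in Icc (a - ρ) (a + ρ), ‖∫ y in Icc (b - ρ) (b + ρ), w x y‖ₑ :=
          enorm_integral_le_lintegral_enorm _
      _ ≤ ∫⁻ x in Icc (a - ρ) (a + ρ), ∫⁻ y in Icc (b - ρ) (b + ρ), ‖w x y‖ₑ :=
          lintegral_mono fun x => enorm_integral_le_lintegral_enorm _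
  -- Step 2: AM–GM inside, then integrate the constants out (inner, then outer)
  have h2 : ∀ x : ℝ, ∫⁻ y in Icc (b - ρ) (b + ρ), ‖w x y‖ₑ ≤
      ENNReal.ofReal (c / 2) * ENNReal.ofReal (2 * ρ) +
        ENNReal.ofReal (1 / (2 * c)) * ∫⁻ y in Icc (b - ρ) (b + ρ), ENNReal.ofReal (w x y ^ 2) := by
    intro x
    calc ∫⁻ y in Icc (b - ρ) (b + ρ), ‖w x y‖ₑ
        ≤ ∫⁻ y in Icc (b - ρ) (b + ρ),
            (ENNReal.ofReal (c / 2) + ENNReal.ofReal (1 / (2 * c)) * ENNReal.ofReal (w x y ^ 2)) :=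
          lintegral_mono fun y => enorm_le_amgm (w x y) hcpos
      _ = ENNReal.ofReal (c / 2) * ENNReal.ofReal (2 * ρ) +
            ENNReal.ofReal (1 / (2 * c)) * ∫⁻ y in Icc (b - ρ) (b + ρ), ENNReal.ofReal (w x y ^ 2) := by
          rw [lintegral_add_left measurable_const, setLIntegral_const, hvol,
            lintegral_const_mul' _ _ ENNReal.ofReal_ne_top]
  have h3 : ENNReal.ofReal Γ₀ ≤
      ENNReal.ofReal (c / 2) * ENNReal.ofReal (2 * ρ) * ENNReal.ofReal (2 * ρ) +
        ENNReal.ofReal (1 / (2 * c)) * W := by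
    calc ENNReal.ofReal Γ₀ ≤ _ := h1
      _ ≤ ∫⁻ x in Icc (a - ρ) (a + ρ), (ENNReal.ofReal (c / 2) * ENNReal.ofReal (2 * ρ) +
            ENNReal.ofReal (1 / (2 * c)) * ∫⁻ y in Icc (b - ρ) (b + ρ), ENNReal.ofReal (w x y ^ 2)) :=
          lintegral_mono fun x => h2 x
      _ = _ := by
          rw [lintegral_add_left measurable_const, setLIntegral_const, hvol,
            lintegral_const_mul' _ _ ENNReal.ofReal_ne_top]
  -- Step 3: real arithmetic with `c = Γ₀/(4ρ²)`
  have hWr : W = ENNReal.ofReal W.toReal := (ENNReal.ofReal_toReal hWtop).symm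
  have hWr0 : 0 ≤ W.toReal := ENNReal.toReal_nonneg
  rw [hWr] at h3 ⊢
  rw [← ENNReal.ofReal_mul (by positivity), ← ENNReal.ofReal_mul (by positivity),
    ← ENNReal.ofReal_mul (by positivity), ← ENNReal.ofReal_add (by positivity) (by positivity),
    ENNReal.ofReal_le_ofReal_iff (by positivity)] at h3
  refine ENNReal.ofReal_le_ofReal ?_
  have e1 : c / 2 * (2 * ρ) * (2 * ρ) = Γ₀ / 2 := by
    rw [hc]; field_simp; ring
  have e2 : 1 / (2 * c) * W.toReal = 2 * ρ ^ 2 * W.toReal / Γ₀ := by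
    rw [hc]; field_simp; ring
  rw [e1, e2] at h3
  have h4 : Γ₀ / 2 ≤ 2 * ρ ^ 2 * W.toReal / Γ₀ := by linarith
  rw [le_div_iff₀ hΓpos] at h4
  rw [div_le_iff₀ (by positivity)]
  nlinarith

/-- **Box floor for the dissipation integrand.** A box of half-side `ρ` carrying circulation `|Γ_Q| ≥ Γ₀`
forces `∫⁻_{x ∈ [a-ρ, a+ρ]} ∫⁻_y |∇(f, g)|² ≥ Γ₀²/(8ρ²)` (`ω² ≤ 2|∇(f,g)|²` and `sq_le_box_lintegral`). [folklore] -/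
theorem box_floor {f g : ℝ → ℝ → ℝ} {a b ρ Γ₀ : ℝ} (hρ : 0 < ρ) (hΓ₀ : 0 ≤ Γ₀)
    (hbox : Γ₀ ≤ |boxCirc f g a b ρ|) :
    ENNReal.ofReal (Γ₀ ^ 2 / (8 * ρ ^ 2)) ≤ ∫⁻ x in Icc (a - ρ) (a + ρ), ∫⁻ y,
      ENNReal.ofReal (dX f x y ^ 2 + dY f x y ^ 2 + dX g x y ^ 2 + dY g x y ^ 2) := by
  have h := sq_le_box_lintegral (w := vort f g) hρ hΓ₀ hbox
  have hhalf : ENNReal.ofReal (Γ₀ ^ 2 / (8 * ρ ^ 2)) =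
      ENNReal.ofReal (1 / 2) * ENNReal.ofReal (Γ₀ ^ 2 / (4 * ρ ^ 2)) := by
    rw [← ENNReal.ofReal_mul (by norm_num)]
    congr 1
    ring
  rw [hhalf]
  calc ENNReal.ofReal (1 / 2) * ENNReal.ofReal (Γ₀ ^ 2 / (4 * ρ ^ 2))
      ≤ ENNReal.ofReal (1 / 2) * ∫⁻ x in Icc (a - ρ) (a + ρ), ∫⁻ y in Icc (b - ρ) (b + ρ),
          ENNReal.ofReal (vort f g x y ^ 2) := mul_le_mul_right h _
    _ ≤ ∫⁻ x in Icc (a - ρ) (a + ρ), ENNReal.ofReal (1 / 2) * ∫⁻ y in Icc (b - ρ) (b + ρ),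
          ENNReal.ofReal (vort f g x y ^ 2) := lintegral_const_mul_le _ _
    _ ≤ ∫⁻ x in Icc (a - ρ) (a + ρ), ∫⁻ y in Icc (b - ρ) (b + ρ),
          ENNReal.ofReal (1 / 2) * ENNReal.ofReal (vort f g x y ^ 2) :=
        lintegral_mono fun x => lintegral_const_mul_le _ _
    _ ≤ ∫⁻ x in Icc (a - ρ) (a + ρ), ∫⁻ y in Icc (b - ρ) (b + ρ),
          ENNReal.ofReal (dX f x y ^ 2 + dY f x y ^ 2 + dX g x y ^ 2 + dY g x y ^ 2) := by
        refine lintegral_mono fun x => lintegral_mono fun y => ?_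
        rw [← ENNReal.ofReal_mul (by norm_num)]
        exact ENNReal.ofReal_le_ofReal (by linarith [vort_sq_le f g x y])
    _ ≤ _ := lintegral_mono fun x => setLIntegral_le_lintegral _ _

/-! ## §3 Periodic windows -/

/-- All windows `(s, s + ℓ]` of an `ℓ`-periodic `ℝ≥0∞`-valued function have the same lower integral
(both equal the integral of the lift over `AddCircle ℓ`). [folklore] -/
theorem setLIntegral_Ioc_periodic {H : ℝ → ℝ≥0∞} {ℓ : ℝ} (hℓ : 0 < ℓ) (hH : Periodic H ℓ) (s t : ℝ) :
    ∫⁻ x in Ioc s (s + ℓ), H x = ∫⁻ x in Ioc t (t + ℓ), H x := by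
  haveI : Fact (0 < ℓ) := ⟨hℓ⟩
  have hs : ∫⁻ x in Ioc s (s + ℓ), H x = ∫⁻ z : AddCircle ℓ, hH.lift z :=
    AddCircle.lintegral_preimage ℓ s hH.lift
  have ht : ∫⁻ x in Ioc t (t + ℓ), H x = ∫⁻ z : AddCircle ℓ, hH.lift z :=
    AddCircle.lintegral_preimage ℓ t hH.lift
  rw [hs, ht]

/-- `(0, kℓ]` is `k` windows: `∫⁻_{(0, kℓ]} H = k · ∫⁻_{(t, t+ℓ]} H` for an `ℓ`-periodic `H`. [folklore] -/
theorem setLIntegral_Ioc_nat_mul_periodic {H : ℝ → ℝ≥0∞} {ℓ : ℝ} (hℓ : 0 < ℓ) (hH : Periodic H ℓ)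
    (t : ℝ) : ∀ k : ℕ, ∫⁻ x in Ioc 0 ((k : ℝ) * ℓ), H x = k * ∫⁻ x in Ioc t (t + ℓ), H x := by
  intro k
  induction k with
  | zero => simp
  | succ k ih =>
    have hk : (0 : ℝ) ≤ k * ℓ := by positivity
    have hk' : (k : ℝ) * ℓ ≤ k * ℓ + ℓ := by linarith
    push_cast
    rw [show ((k : ℝ) + 1) * ℓ = k * ℓ + ℓ by ring, ← Ioc_union_Ioc_eq_Ioc hk hk',
      lintegral_union measurableSet_Ioc (Ioc_disjoint_Ioc_of_le le_rfl), ih,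
      setLIntegral_Ioc_periodic hℓ hH (k * ℓ) t]
    ring

/-! ## §4 The floor of one time slice -/

/-- **Slice floor.** For `ℓ`-periodic-in-`x` plane fields `(f, g)` with a box of half-side `ρ ≤ ℓ/2` carrying
circulation `|Γ_Q| ≥ Γ₀`, the dissipation per unit area over the period `nℓ` (`n ≥ 1`) is at least
`ν Γ₀² / (8 ρ² ℓ)`: `n` translated copies of the box sit in `(0, nℓ] × ℝ` up to the window shift. [folklore] -/
theorem layerDissipation_floor {ν ℓ ρ Γ₀ : ℝ} {n : ℕ} {f g : ℝ → ℝ → ℝ}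
    (hν : 0 ≤ ν) (hℓ : 0 < ℓ) (hn : 1 ≤ n) (hρ : 0 < ρ) (hρℓ : 2 * ρ ≤ ℓ) (hΓ₀ : 0 ≤ Γ₀)
    (hper : ∀ x y : ℝ, f (x + ℓ) y = f x y ∧ g (x + ℓ) y = g x y)
    {a b : ℝ} (hbox : Γ₀ ≤ |boxCirc f g a b ρ|) :
    ENNReal.ofReal (ν * Γ₀ ^ 2 / (8 * ρ ^ 2 * ℓ)) ≤ layerDissipation ν (n * ℓ) f g := by
  set E : ℝ → ℝ≥0∞ := fun x => ∫⁻ y,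
    ENNReal.ofReal (dX f x y ^ 2 + dY f x y ^ 2 + dX g x y ^ 2 + dY g x y ^ 2) with hE
  have hEper : Periodic E ℓ := by
    intro x
    simp only [hE, dX_add_period (fun x y => (hper x y).1), dY_add_period (fun x y => (hper x y).1),
      dX_add_period (fun x y => (hper x y).2), dY_add_period (fun x y => (hper x y).2)]
  have hwin := setLIntegral_Ioc_nat_mul_periodic hℓ hEper (a - ρ) n
  have hIcc : ∫⁻ x in Icc (a - ρ) (a + ρ), E x = ∫⁻ x in Ioc (a - ρ) (a + ρ), E x :=
    setLIntegral_congr Ioc_ae_eq_Icc.symm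
  have hsub : ∫⁻ x in Ioc (a - ρ) (a + ρ), E x ≤ ∫⁻ x in Ioc (a - ρ) (a - ρ + ℓ), E x :=
    lintegral_mono_set (Ioc_subset_Ioc_right (by linarith))
  have hboxE : ENNReal.ofReal (Γ₀ ^ 2 / (8 * ρ ^ 2)) ≤ ∫⁻ x in Ioc (a - ρ) (a - ρ + ℓ), E x :=
    (box_floor hρ hΓ₀ hbox).trans (hIcc.le.trans hsub)
  have hn0 : (0 : ℝ) < n := by exact_mod_cast hn
  have hreal : ν * Γ₀ ^ 2 / (8 * ρ ^ 2 * ℓ) = ν / (n * ℓ) * (n * (Γ₀ ^ 2 / (8 * ρ ^ 2))) := by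
    field_simp
  rw [layerDissipation_def]
  change _ ≤ ENNReal.ofReal (ν / (n * ℓ)) * ∫⁻ x in Ioc 0 ((n : ℝ) * ℓ), E x
  rw [hwin]
  calc ENNReal.ofReal (ν * Γ₀ ^ 2 / (8 * ρ ^ 2 * ℓ))
      = ENNReal.ofReal (ν / (n * ℓ)) * ((n : ℝ≥0∞) * ENNReal.ofReal (Γ₀ ^ 2 / (8 * ρ ^ 2))) := by
        rw [← ENNReal.ofReal_natCast, ← ENNReal.ofReal_mul n.cast_nonneg,
          ← ENNReal.ofReal_mul (by positivity), hreal]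
    _ ≤ ENNReal.ofReal (ν / (n * ℓ)) * ((n : ℝ≥0∞) * ∫⁻ x in Ioc (a - ρ) (a - ρ + ℓ), E x) := by
        gcongr

/-! ## §5 Cesàro -/

/-- **Cesàro transfer of a late-time floor.** If `K ≤ D t` for all `t ≥ T₂ ≥ 0`, then
`K ≤ liminf_T T⁻¹ ∫⁻_{(0,T]} D`: indeed `T⁻¹ ∫⁻_{(0,T]} D ≥ T⁻¹ (T − T₂) K → K`. [folklore] -/
theorem le_liminf_cesaro_of_floor {D : ℝ → ℝ≥0∞} {K : ℝ≥0∞} {T₂ : ℝ} (hT₂ : 0 ≤ T₂)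
    (h : ∀ t : ℝ, T₂ ≤ t → K ≤ D t) :
    K ≤ liminf (fun T : ℝ => ENNReal.ofReal T⁻¹ * ∫⁻ t in Ioc 0 T, D t) atTop := by
  have hg : Tendsto (fun T : ℝ => K * ENNReal.ofReal (1 - T₂ * T⁻¹)) atTop (𝓝 K) := by
    have h1 : Tendsto (fun T : ℝ => 1 - T₂ * T⁻¹) atTop (𝓝 (1 - T₂ * 0)) :=
      tendsto_const_nhds.sub (tendsto_inv_atTop_zero.const_mul T₂)
    rw [mul_zero, sub_zero] at h1
    have h2 := ENNReal.tendsto_ofReal h1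
    rw [ENNReal.ofReal_one] at h2
    have h3 := ENNReal.Tendsto.const_mul (a := K) h2 (Or.inl one_ne_zero)
    rwa [mul_one] at h3
  rw [← hg.liminf_eq]
  refine liminf_le_liminf ?_
  filter_upwards [eventually_gt_atTop T₂] with T hT
  have hT0 : 0 < T := hT₂.trans_lt hT
  have hsub : Ioc T₂ T ⊆ Ioc 0 T := Ioc_subset_Ioc_left hT₂
  calc K * ENNReal.ofReal (1 - T₂ * T⁻¹)
      = K * (ENNReal.ofReal T⁻¹ * ENNReal.ofReal (T - T₂)) := by
        rw [← ENNReal.ofReal_mul (inv_nonneg.2 hT0.le),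
          show (1 - T₂ * T⁻¹ : ℝ) = T⁻¹ * (T - T₂) by field_simp]
    _ = ENNReal.ofReal T⁻¹ * (K * volume (Ioc T₂ T)) := by rw [Real.volume_Ioc]; ring
    _ = ENNReal.ofReal T⁻¹ * ∫⁻ _ in Ioc T₂ T, K := by rw [setLIntegral_const]
    _ ≤ ENNReal.ofReal T⁻¹ * ∫⁻ t in Ioc T₂ T, D t :=
        mul_le_mul_right (setLIntegral_mono' measurableSet_Ioc fun t ht => h t ht.1.le) _
    _ ≤ ENNReal.ofReal T⁻¹ * ∫⁻ t in Ioc 0 T, D t := mul_le_mul_right (lintegral_mono_set hsub) _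

/-! ## §6 The stub -/

/-- **Stub `stub_coreFloor` (the transfer).** From time `T₂ > 0` on, some box of half-side `ρ ≤ ℓ/2` of every
slice carries circulation `≥ Γ₀`; then the Cesàro mean dissipation per unit area over the period `nℓ` is at least
`ν Γ₀² / (8 ρ² ℓ)` (`layerDissipation_floor` for each late slice, `le_liminf_cesaro_of_floor`). The regularity
hypothesis is not needed by this `ℝ≥0∞` route (non-integrable slices only help). [folklore] -/
theorem stub_coreFloor {ν ℓ ρ Γ₀ T₂ : ℝ} {n : ℕ} {u v : ℝ → ℝ → ℝ → ℝ}
    (hν : 0 < ν) (hℓ : 0 < ℓ) (hn : 1 ≤ n) (hρ : 0 < ρ) (hρℓ : 2 * ρ ≤ ℓ) (hΓ₀ : 0 ≤ Γ₀) (hT₂ : 0 < T₂)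
    (hreg : ∀ t : ℝ, 0 < t →
      ContDiff ℝ 2 (fun q : ℝ × ℝ => u t q.1 q.2) ∧ ContDiff ℝ 2 (fun q : ℝ × ℝ => v t q.1 q.2))
    (hper : ∀ t x y : ℝ, 0 < t → u t (x + ℓ) y = u t x y ∧ v t (x + ℓ) y = v t x y)
    (hcore : ∀ t : ℝ, T₂ ≤ t → ∃ a b : ℝ, Γ₀ ≤ |boxCirc (u t) (v t) a b ρ|) :
    ENNReal.ofReal (ν * Γ₀ ^ 2 / (8 * ρ ^ 2 * ℓ)) ≤ meanLayerDissipation ν (n * ℓ) u v := by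
  have _ := hreg
  rw [meanLayerDissipation_def]
  refine le_liminf_cesaro_of_floor hT₂.le fun t ht => ?_
  obtain ⟨a, b, hab⟩ := hcore t ht
  exact layerDissipation_floor hν.le hℓ hn hρ hρℓ hΓ₀ (fun x y => hper t x y (hT₂.trans_le ht)) hab

end Summit.AnomalousDissipation.AnomalousDissipation.Theorems.StrainedLayerLaw.ContractionCapture

end
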